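import Summits.BirchSwinnertonDyer.BirchSwinnertonDyer.Theses.KatoDescentPotSupersingular
import Summits.BirchSwinnertonDyer.Rank1Residual.Additive.X4RankZeroKatoBoundTamagawaExact
import HarnessLib

/-!
# Route `KatoDescentPotSupersingular` (rung K9, cell `bsd-potss`): the crux `WildUpperDefectRankZero`
# (U₀, item stmt-BirchSwinnertonDyer-19197) LOSES ITS TAMAGAWA / MANIN DEFECT ROWS — the upper half on every
# irreducible TOWER-SURJECTIVE wild rank-`0` row from Kato's Tamagawa-exact reading (a `--supports` file)

The route's defect predicate for the irreducible rows is `¬(towerSurj ∧ 3 ∤ Tam(E) ∧ ∃ D, 3 ∤ c_D)`, because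
the covered rows were typed through `ClassO6.missingPPartAt_iff_lower_of_kato`, i.e. through the named fact
`Kato2004.rankZero_padicValNat_sha_le_of_additive_potGood_of_imageContainsSL2` (A161: Kato Thm. 14.5 (3)
⊕ Prop. 14.16 (2) WITH Kim–Nakamura's binders `p ∤ Tam(E)` and a Manin datum). The tree ALSO holds the
Tamagawa-EXACT, Manin-FREE reading of the same pages,
`Kato2004.rankZero_padicValNat_sha_add_padicValNat_tamagawa_le_of_additive_potGood_of_imageContainsSL2`
(A161″: `ord_p #Ш(p) + v_p(Tam) ≤ ord_p(L(E,1)/Ω)` — Kato §14.8 read with Greenberg's Prop. 4.13, Lemma T;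
cell `b2b-bsdres` harvest, audited `KATO2004-TYPING.md` §29; it implies A161:
`Kato2004.rankZero_padicValNat_sha_le_of_additive_potGood_of_imageContainsSL2_of_tamagawaExact`), and
its consumer `X4RankZero.missingUpperBoundAt_of_katoTam` ("THE TYPED UPPER HALF WITHOUT ANY TAMAGAWA,
MANIN OR PARITY BINDER"). Hence, granted A161″ + GZK + modularity (published inputs of the same standing
as `PublishedInputsO6`'s), **every irreducible O6 row of analytic rank `0` whose 3-adic tower image is
surjective has the upper half `ord₃ #Ш ≤ ord₃ #Ш_an` — whether or not `3 ∣ Tam(E)` and with no Manin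
datum**: the rows "`3 ∣ c_ℓ` adds a Tamagawa defect" and "`3 ∣ c_D` for every parametrisation" of the
crux's why-it-might-fail are NOT defect rows. What remains of U₀ on the irreducible side is exactly the
tower-NON-surjective rows (surjective mod `3` but not mod `9`: outside (12.5.2)); on the reducible side,
the `ℤ/9`-member classes and the odd-`ord₃ #Ш_an` rows (untouched here). The last theorem records the
resulting RESHAPED composition of the crux (two smaller stubs ⟹ `WildUpperDefectRankZero`), for the
route's tenure planner. Conditional on the displayed named facts; the item is NOT closed. Seat
`bsd-potss-kmc` generation 6 (part 12c).

References: [Kato2004Asterisque] Thm. 14.5 (3) (p. 236), Prop. 14.16 (2) (p. 244), §14.8 (p. 238),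
(12.5.2) (p. 222); [GreenbergLNM1716] Prop. 4.13; [Miller2011LMS] Def. 1.1.
-/

set_option autoImplicit false
-- sibling precedent (`KatoDescentPotSupersingularAssembly.lean`): the directory name repeats the summit name
set_option linter.dupNamespace false

noncomputable section

open scoped Classical

namespace Summit.BirchSwinnertonDyer.BirchSwinnertonDyer.Theorems

open WeierstrassCurve Literature.NumberTheory.EllipticCurves
  Literature.NumberTheory.EllipticCurves.ModularForms
  Literature.NumberTheory.EllipticCurves.Rank1Residual
  Literature.NumberTheory.EllipticCurves.Rank1Residual.Typed
  Summit.BirchSwinnertonDyer.Rank1Residual.Additive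
  Summit.BirchSwinnertonDyer.Rank1Residual
  Summit.BirchSwinnertonDyer.BirchSwinnertonDyer.Theses.KatoDescentPotSupersingular

/-- **The upper half on EVERY irreducible tower-surjective wild rank-`0` row, Tamagawa- and Manin-free**
(granted A161″ = Kato's Tamagawa-exact reading, GZK and modularity): for `W/ℚ` globally minimal in
`ClassO6 W 3` with `r_an = 0` and `ρ_{E,3^n}` onto for every `n`, `MissingUpperBoundAt W 3`. Tower
surjectivity at level `3¹` gives `E[3]` irreducible, so the pair is in `ClassX4`; `ord₃ j ≥ 0` comes with
`ClassO6`; then `X4RankZero.missingUpperBoundAt_of_katoTam`. No hypothesis on `Tam(E)`, no modular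
parametrisation datum. [cite: Kato2004Asterisque, Thm. 14.5 (3) (p. 236), Prop. 14.16 (2) (p. 244), §14.8 (p. 238)]
[cite: GreenbergLNM1716, §4 Prop. 4.13] -/
theorem missingUpperBoundAt_wild_of_towerSurj_of_katoTam
    (hKatoT :
      Kato2004.rankZero_padicValNat_sha_add_padicValNat_tamagawa_le_of_additive_potGood_of_imageContainsSL2)
    (hGZK : rank_eq_analyticRank_of_analyticRank_le_one) (hmod : hasEntireLFunction_rat)
    (W : WeierstrassCurve ℚ) [W.IsElliptic] [W.IsGloballyMinimal] [Fact (3 : ℕ).Prime]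
    (hr : W.analyticRank = 0) (hO : ClassO6 W 3)
    (hsurj : ∀ n : ℕ, W.HasSurjectiveModNGaloisRep (3 ^ n : ℕ)) : MissingUpperBoundAt W 3 := by
  have hirr : W.HasIrreducibleModPGaloisRep 3 := by
    have h1 := hsurj 1
    simp only [pow_one] at h1
    exact hasIrreducibleModPGaloisRep_of_hasSurjectiveModNGaloisRep W 3 (by exact_mod_cast h1)
  exact X4RankZero.missingUpperBoundAt_of_katoTam W 3 hKatoT hGZK hmod hr ⟨hO.1, hO.2.1, hirr⟩
    hO.padicValRat_j_nonneg hsurj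

/-- **The registered stub `stub_upper_irredDefect` of the crux `WildUpperDefectRankZero`, restricted to the
tower-SURJECTIVE rows, holds** (granted A161″, GZK, modularity): the defect hypothesis
`¬(towerSurj ∧ 3 ∤ Tam ∧ ∃ D, 3 ∤ c_D)` is simply not needed there. So the irreducible defect rows of U₀
are only the tower-non-surjective ones. [cite: Kato2004Asterisque, Thm. 14.5 (3) (p. 236), Prop. 14.16 (2) (p. 244)]
[cite: GreenbergLNM1716, §4 Prop. 4.13] -/
theorem upper_irredDefect_of_towerSurj_of_katoTam
    (hKatoT :
      Kato2004.rankZero_padicValNat_sha_add_padicValNat_tamagawa_le_of_additive_potGood_of_imageContainsSL2)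
    (hGZK : rank_eq_analyticRank_of_analyticRank_le_one) (hmod : hasEntireLFunction_rat)
    (W : WeierstrassCurve ℚ) [W.IsElliptic] [W.IsGloballyMinimal] [Fact (3 : ℕ).Prime]
    (hr : W.analyticRank = 0) (hO : ClassO6 W 3) (_hI : W.HasIrreducibleModPGaloisRep 3)
    (hsurj : ∀ n : ℕ, W.HasSurjectiveModNGaloisRep (3 ^ n : ℕ))
    (_hdef : ¬ ((∀ n : ℕ, W.HasSurjectiveModNGaloisRep (3 ^ n : ℕ)) ∧ ¬ 3 ∣ W.tamagawaProduct ∧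
        ∃ (N : ℕ) (_ : NeZero N) (D : ModularParametrizationData W N), ¬ (3 : ℤ) ∣ D.maninConstant)) :
    MissingUpperBoundAt W 3 :=
  missingUpperBoundAt_wild_of_towerSurj_of_katoTam hKatoT hGZK hmod W hr hO hsurj

/-- **RESHAPED COMPOSITION of the crux `WildUpperDefectRankZero` (for the route's tenure planner):
granted A161″ + GZK + modularity, U₀ follows from TWO SMALLER statements** — (i) the upper half on the
irreducible rows whose 3-adic tower image is NOT surjective (the only irreducible defect rows left), and
(ii) the upper half on the reducible defect rows (a `ℤ/9` member in the class, or odd `ord₃ #Ш_an`) — in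
place of the registered `stub_upper_irredDefect` / `stub_upper_redDefect` (the first of which also carried
the `3 ∣ Tam` and Manin rows). Pure bookkeeping; nothing about (i), (ii) or the named facts is asserted.
[cite: Kato2004Asterisque, Thm. 14.5 (3) (p. 236), Prop. 14.16 (2) (p. 244), §14.8 (p. 238)]
[cite: GreenbergLNM1716, §4 Prop. 4.13] -/
theorem wildUpperDefectRankZero_of_nonsurj_of_redDefect_of_katoTam
    (hKatoT :
      Kato2004.rankZero_padicValNat_sha_add_padicValNat_tamagawa_le_of_additive_potGood_of_imageContainsSL2)
    (hGZK : rank_eq_analyticRank_of_analyticRank_le_one) (hmod : hasEntireLFunction_rat)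
    (hns : ∀ (W : WeierstrassCurve ℚ) [W.IsElliptic] [W.IsGloballyMinimal] [Fact (3 : ℕ).Prime],
      W.analyticRank = 0 → ClassO6 W 3 → W.HasIrreducibleModPGaloisRep 3 →
      ¬ (∀ n : ℕ, W.HasSurjectiveModNGaloisRep (3 ^ n : ℕ)) → MissingUpperBoundAt W 3)
    (hred : ∀ (W : WeierstrassCurve ℚ) [W.IsElliptic] [W.IsGloballyMinimal] [Fact (3 : ℕ).Prime],
      W.analyticRank = 0 → ClassO6 W 3 → ¬ W.HasIrreducibleModPGaloisRep 3 →
      ¬ ((∀ (W' : WeierstrassCurve ℚ) [W'.IsElliptic], IsIsogenous W W' → ¬ 3 ^ 2 ∣ W'.torsionOrder) ∧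
          ∀ q : ℚ, shaAn W = (q : ℂ) → Even (padicValRat 3 q)) →
      MissingUpperBoundAt W 3) :
    Summit.BirchSwinnertonDyer.BirchSwinnertonDyer.Theses.KatoDescentPotSupersingular.WildUpperDefectRankZero := by
  intro W _ _ _ hr hO hcov
  by_cases hI : W.HasIrreducibleModPGaloisRep 3
  · by_cases hsurj : ∀ n : ℕ, W.HasSurjectiveModNGaloisRep (3 ^ n : ℕ)
    · exact missingUpperBoundAt_wild_of_towerSurj_of_katoTam hKatoT hGZK hmod W hr hO hsurj
    · exact hns W hr hO hI hsurj
  · exact hred W hr hO hI (fun h ↦ hcov (Or.inr ⟨hI, h⟩))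

end Summit.BirchSwinnertonDyer.BirchSwinnertonDyer.Theorems

end
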